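/-
Copyright: the b2b-balaban cell (near-miss cell 7), T⁴-continuum fan-out, lineage t4-ne7b-p3 (node U5c LARGE-DEVIATION
member P3).  Released under the licence of the surrounding project.
-/
import Literature.MathematicalPhysics.QuantumFieldTheory.Balaban1983to89.B16SProfile
import Summits.QuantumFields.BalabanUV.T4Continuum.Support.SpaceTimeVolume

/-!
# Space-time Peierls ∕ Cramér route for NE7b — A REALISED LINEAGE IN THE INDEX MODEL, I (skeleton row ST3): pieces,
# S-evolved domains, skeletons, and THE TREE LENGTH OF THE SKELETON from the geometry of `B16SProfile` ∕ `TreeLength`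

Summits-side support leaf of the T⁴-continuum cell (rung (B)+1 on a FINITE torus only; NOT infinite volume, NOT the
mass gap, NOT the Clay statement; NOT a proof of the spine estimate NE7b).  Lineage `t4-ne7b-p3` (generation 2), node
U5c, skeleton `t4/skeletons/NE7b-t4-ne7b-p3.md` leaf A2b (volume side) ∕ A3b, rows ST3 ∕ ST5.  [folklore] finite
combinatorics and real arithmetic over the row's shared genealogy carrier `T4PersistenceDictionary.Gen` (lineage
t4-ne7b-p1) and the cell's KERNEL-CHECKED index model of Bałaban's operation `S` (`B16SProfile`: `Siter`, `closureIdx`,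
`box`, `DropCtl`, `ratio`; `TreeLength.treeLen`, `card_le_treeLen`, `mul_treeLen_closureIdx_le`,
`treeLen_biUnion_add_two_le`; `B13ScaleTransfer.FaceConnected`) — all imported BY NAME, nothing modified; nothing is
quoted from print here and nothing printed is asserted; no `[cite:]` tag.

WHAT.  `SpaceTimeVolume.volumeAccounting_of_consistent` consumes ONE displayed binder: the contour volume is at most
`cA·treeD + cB·treeSteps` — every structure-step `(V, n)` of the lineage occupies at most `cA·D_n(V) + cB` cells.  This
file PROVES that binder's per-structure-step content on a REALISED genealogy in the index model `ℤᵈ` of the cube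
partitions: every event `e` of the genealogy creates a PIECE `piece e ⊆ ℤᵈ` at its step `step e` (a birth: the new
region; a merger: the connector cubes; a renewal: nothing), and the structure described by a (sub-)genealogy `V` occupies
at step `n` the union of the S-ITERATES of its pieces, `dom V n = ⋃_e S^{n − step e}(piece e)` (§1; `S` distributes over
unions, `B16SProfile.Siter_biUnion`, so this IS the S-evolution of the merged domains).  Its SKELETON is the union of the
covers, `skel V n = ⋃_e (piece e)^{(n − step e)}`.
* §1 cumulative coarsening `Qs q s n` from step `s` to step `n` along a global ratio sequence, covers compose
  (`skel_of_le`: `skel V n = closureIdx (Qs s n) (skel V s)`), the realised data predicate `SkelOK` (pieces of births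
  nonempty face-connected with tree length ≤ the class `fat b`; renewals create nothing; at a merger the merged skeleton
  is FACE-CONNECTED — the reading «joined together … by adding layers of cubes» — and the connector's tree length `+ 4`
  is at most `dC`; chronology);
* §2 **`treeLen_skel_le`**: `treeLen (skel V n) ≤ DQ V n`, where `DQ` is the modelled profile with EXACT coarsening
  weights `1 ∕ Qs` (births `fat b ∕ Qs`, connectors `dC ∕ Qs`): exact coarsening `Q·treeLen(closureIdx Q X) ≤ treeLen X`
  along event-free stretches, gluing `treeLen(A ∪ B ∪ C) ≤ ΣtreeLen + 4` ONCE per merger, and the telescoping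
  `Qs a n = Qs a s · Qs s n` — NO compounding across nested mergers;
* the companion file `SpaceTimeRealisedCells` adds the drop control (`DropCtl σ m`, `L ≥ 4`): `1 ∕ Qs ≤ 2·decay`,
  the radius-31 boxes around the covers (`B16SProfile.Siter_subset_biUnion_box`), `#dom V n ≤ 8·126^d·Dfun V n + 126^d`
  per structure-step and, summed over the history tree, `treeCells V t ≤ 8·126^d·treeD V t + 126^d·treeSteps V t` —
  the cell binder of `SpaceTimeAssembly.LineageReadings`.
So the volume side of A2b is KERNEL modulo: the identification of Bałaban's domains with `dom` (pieces + S-evolution),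
the connectedness of merged skeletons, the class∕connector bounds, and `DropCtl` (typed flow, `B16SProfile.dropCtl_of_27b`).

HONEST DEPENDENCY (cell, verbatim): continuum YM on T⁴ ⇐ BetaPertH ∧ nine spine estimates (0/9 proved); BetaPertH ⇐
(D1) ∧ (D4) ∧ CAP+tail; G-an2-4 gates asym, D1 and NE2/3/4.  This file changes none of it.
-/

open Finset

namespace Summit.QuantumFields.BalabanUV.T4Continuum.SpaceTimePeierls

open Literature.MathematicalPhysics.QuantumFieldTheory.Balaban1983to89
open Literature.MathematicalPhysics.QuantumFieldTheory.Balaban1983to89.B13ScaleTransfer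
open Literature.MathematicalPhysics.QuantumFieldTheory.Balaban1983to89.TreeLength
open Literature.MathematicalPhysics.QuantumFieldTheory.Balaban1983to89.B16SProfile
open T4PersistenceDictionary

noncomputable section

/-! ## §1 Cumulative coarsening, pieces, domains and skeletons -/

section Realised

variable {d : ℕ}

/-- **CUMULATIVE COARSENING** from step `s` to step `n` along the global ratio sequence `q` (`q l` = the ratio of the
cube sides of the partitions at steps `l` and `l + 1`): `Qs q s n = q s · q (s+1) ⋯ q (n−1)`. [folklore] -/
def Qs (q : ℕ → ℕ) (s n : ℕ) : ℕ := Qprod (fun l => q (s + l)) (n - s)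

/-- no coarsening from a step to itself [folklore] -/
@[simp] theorem Qs_self (q : ℕ → ℕ) (s : ℕ) : Qs q s s = 1 := by simp [Qs]

/-- one more step [folklore] -/
theorem Qs_succ (q : ℕ → ℕ) {s n : ℕ} (h : s ≤ n) : Qs q s (n + 1) = Qs q s n * q n := by
  unfold Qs
  rw [show n + 1 - s = (n - s) + 1 by omega, Qprod_succ, show s + (n - s) = n by omega]

/-- coarsenings compose: `Qs a n = Qs a s · Qs s n`. [folklore] -/
theorem Qs_trans (q : ℕ → ℕ) {a s n : ℕ} (h1 : a ≤ s) (h2 : s ≤ n) : Qs q a n = Qs q a s * Qs q s n := by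
  induction n, h2 using Nat.le_induction with
  | base => simp
  | succ n hn ih => rw [Qs_succ q (h1.trans hn), Qs_succ q hn, ih, mul_assoc]

/-- positivity [folklore] -/
theorem Qs_pos {q : ℕ → ℕ} (hq : ∀ l, 0 < q l) (s n : ℕ) : 0 < Qs q s n := Qprod_pos (fun _ => hq _) _

/-- **THE COVER** at step `n` of a piece created at step `s`: `Z^{(n−s)} = closureIdx (Qs s n) Z`. [folklore] -/
def coverAt (q : ℕ → ℕ) (s n : ℕ) (Z : Finset (Pt d)) : Finset (Pt d) := closureIdx (Qs q s n) Z

/-- covers compose along the steps [folklore] -/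
theorem coverAt_trans (q : ℕ → ℕ) {a s n : ℕ} (h1 : a ≤ s) (h2 : s ≤ n) (Z : Finset (Pt d)) :
    coverAt q a n Z = closureIdx (Qs q s n) (coverAt q a s Z) := by
  unfold coverAt
  rw [closureIdx_closureIdx, Qs_trans q h1 h2]

/-- the cover at the creation step is the piece itself [folklore] -/
@[simp] theorem coverAt_self (q : ℕ → ℕ) (s : ℕ) (Z : Finset (Pt d)) : coverAt q s s Z = Z := by
  simp [coverAt, closureIdx_one]

/-- the cover of nothing is nothing [folklore] -/
@[simp] theorem coverAt_empty (q : ℕ → ℕ) (s n : ℕ) : coverAt q s n (∅ : Finset (Pt d)) = ∅ := by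
  simp [coverAt, closureIdx]

variable {ε : Type*} [DecidableEq ε]

/-- **THE SKELETON** of the structure described by `G` at step `n`: the union of the covers of its pieces. [folklore] -/
def skel (q : ℕ → ℕ) (step : ε → ℕ) (piece : ε → Finset (Pt d)) (G : Gen ε) (n : ℕ) : Finset (Pt d) :=
  G.events.biUnion fun e => coverAt q (step e) n (piece e)

variable {q : ℕ → ℕ} {step : ε → ℕ} {piece : ε → Finset (Pt d)}

/-- the skeleton coarsens as one set along event-free stretches: `skel V n = (skel V s)^{(Qs s n)}` when every event of
`V` has happened by step `s ≤ n`. [folklore] -/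
theorem skel_of_le {G : Gen ε} {s n : ℕ} (hG : ∀ e ∈ G.events, step e ≤ s) (h : s ≤ n) :
    skel q step piece G n = closureIdx (Qs q s n) (skel q step piece G s) := by
  unfold skel
  rw [closureIdx_biUnion]
  exact Finset.biUnion_congr rfl fun e he => coverAt_trans q (hG e he) h _

/-- a union over a union of index sets [folklore] -/
theorem biUnion_union' {α β : Type*} [DecidableEq α] [DecidableEq β] (s t : Finset α) (f : α → Finset β) :
    (s ∪ t).biUnion f = s.biUnion f ∪ t.biUnion f := by
  ext x
  simp only [mem_biUnion, mem_union]
  constructor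
  · rintro ⟨a, ha | ha, hx⟩
    · exact Or.inl ⟨a, ha, hx⟩
    · exact Or.inr ⟨a, ha, hx⟩
  · rintro (⟨a, ha, hx⟩ | ⟨a, ha, hx⟩)
    · exact ⟨a, Or.inl ha, hx⟩
    · exact ⟨a, Or.inr ha, hx⟩

/-- the skeleton of a renewed component is the old one (a renewal creates no piece) [folklore] -/
theorem skel_renew (G : Gen ε) {e : ε} (h : ℕ) (he : piece e = ∅) (n : ℕ) :
    skel q step piece (Gen.renew G e h) n = skel q step piece G n := by
  unfold skel
  rw [Gen.events_renew, biUnion_insert, he, coverAt_empty, empty_union]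

/-- the skeleton of a merged component AT THE MERGER STEP: connector ∪ the two partners' skeletons [folklore] -/
theorem skel_merge_self (X Y : Gen ε) (e : ε) :
    skel q step piece (Gen.merge X Y e) (step e) =
      piece e ∪ (skel q step piece X (step e) ∪ skel q step piece Y (step e)) := by
  unfold skel
  rw [Gen.events_merge, biUnion_insert, coverAt_self, biUnion_union']

/-- **THE REALISED DATA PREDICATE** (the reading's obligations, per constructor): a birth's piece is a nonempty
face-connected index set created at the birth step, of tree length at most the class `fat b`; a renewal creates no
piece; at a merger every earlier event precedes the merger step, the merged skeleton at the merger step is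
FACE-CONNECTED (the connector joins the partners), and the connector is empty or face-connected with tree length `+ 4`
at most `dC`.  Hereditary. [folklore] -/
def SkelOK (q : ℕ → ℕ) (step : ε → ℕ) (piece : ε → Finset (Pt d)) (fat : ε → ℕ) (dC : ℝ) : Gen ε → Prop
  | Gen.born b j => step b = j ∧ (piece b).Nonempty ∧ FaceConnected (piece b) ∧ treeLen (piece b) ≤ fat b
  | Gen.renew G e h => SkelOK q step piece fat dC G ∧ piece e = ∅ ∧ step e = h + 1 ∧
      ∀ e' ∈ G.events, step e' ≤ h + 1
  | Gen.merge X Y e => SkelOK q step piece fat dC X ∧ SkelOK q step piece fat dC Y ∧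
      (∀ e' ∈ X.events, step e' ≤ step e) ∧ (∀ e' ∈ Y.events, step e' ≤ step e) ∧
      FaceConnected (skel q step piece (Gen.merge X Y e) (step e)) ∧
      (piece e = ∅ ∨ FaceConnected (piece e)) ∧ treeLen (piece e) + 4 ≤ dC

variable {fat : ε → ℕ} {dC : ℝ}

/-- the step at which the structure appears is the step of its last event [folklore] -/
theorem step_top : ∀ {G : Gen ε}, SkelOK q step piece fat dC G → ∀ e ∈ G.events, step e ≤ step G.top
  | Gen.born b j, _, e, he => by
      simp only [Gen.events_born, mem_singleton] at he
      subst he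
      simp
  | Gen.renew G e h, hok, e', he' => by
      obtain ⟨-, -, hse, hchron⟩ := hok
      rw [Gen.top_renew, hse]
      rw [Gen.events_renew, mem_insert] at he'
      rcases he' with rfl | he'
      · exact hse.le
      · exact hchron e' he'
  | Gen.merge X Y e, hok, e', he' => by
      obtain ⟨-, -, hcX, hcY, -⟩ := hok
      rw [Gen.top_merge]
      rw [Gen.events_merge, mem_insert, mem_union] at he'
      rcases he' with rfl | he' | he'
      · exact le_rfl
      · exact hcX e' he'
      · exact hcY e' he'

end Realised

/-! ## §2 The tree length of the skeleton: exact coarsening, one gluing per merger -/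

section TreeLen

variable {d : ℕ} {ε : Type*} [DecidableEq ε] {q : ℕ → ℕ} {step : ε → ℕ} {piece : ε → Finset (Pt d)}
  {fat : ε → ℕ} {dC : ℝ}

/-- **THE MODELLED PROFILE WITH EXACT COARSENING WEIGHTS**: births `fat b ∕ Qs j n`, connectors `dC ∕ Qs (step e) n`,
renewals nothing — `Dfun` with `decay` replaced by `1 ∕ Qs`. [folklore] -/
def DQ (q : ℕ → ℕ) (fat : ε → ℕ) (step : ε → ℕ) (dC : ℝ) : Gen ε → ℕ → ℝ
  | Gen.born b j, n => (fat b : ℝ) / Qs q j n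
  | Gen.renew G _ _, n => DQ q fat step dC G n
  | Gen.merge X Y e, n => DQ q fat step dC X n + DQ q fat step dC Y n + dC / Qs q (step e) n

/-- the exact profile telescopes: `DQ V n = DQ V s ∕ Qs s n` once every event of `V` has happened by `s ≤ n`.
[folklore] -/
theorem DQ_of_le (hq : ∀ l, 0 < q l) :
    ∀ {G : Gen ε}, SkelOK q step piece fat dC G → ∀ {s n : ℕ}, (∀ e ∈ G.events, step e ≤ s) → s ≤ n →
      DQ q fat step dC G n = DQ q fat step dC G s / Qs q s n
  | Gen.born b j, hok, s, n, hs, hsn => by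
      obtain ⟨hb, -⟩ := hok
      have hj : j ≤ s := by have := hs b (by simp); rw [hb] at this; exact this
      simp only [DQ]
      rw [Qs_trans q hj hsn, Nat.cast_mul, div_div]
  | Gen.renew G e h, hok, s, n, hs, hsn => by
      obtain ⟨hG, -⟩ := hok
      simp only [DQ]
      exact DQ_of_le hq hG (fun e' he' => hs e' (by simp [he'])) hsn
  | Gen.merge X Y e, hok, s, n, hs, hsn => by
      obtain ⟨hX, hY, -⟩ := hok
      have he : step e ≤ s := hs e (by simp)
      simp only [DQ]
      rw [DQ_of_le hq hX (fun e' he' => hs e' (by simp [he'])) hsn,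
        DQ_of_le hq hY (fun e' he' => hs e' (by simp [he'])) hsn,
        Qs_trans q he hsn, Nat.cast_mul]
      ring

/-- gluing two: `treeLen (A ∪ B) ≤ treeLen A + treeLen B + 2` for nonempty face-connected `A`, `B` with a face-connected
union (`TreeLength.treeLen_biUnion_add_two_le`). [folklore] -/
theorem treeLen_union_le {A B : Finset (Pt d)} (hA : A.Nonempty) (hAc : FaceConnected A) (hB : B.Nonempty)
    (hBc : FaceConnected B) (hU : FaceConnected (A ∪ B)) : treeLen (A ∪ B) ≤ treeLen A + treeLen B + 2 := by
  classical
  by_cases hAB : A = B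
  · subst hAB
    rw [union_idempotent]
    linarith [treeLen_nonneg A]
  · have hD : ({A, B} : Finset (Finset (Pt d))).biUnion id = A ∪ B := by simp
    have h := treeLen_biUnion_add_two_le (D := {A, B}) ⟨A, by simp⟩
      (fun Y hY => by
        simp only [mem_insert, mem_singleton] at hY
        rcases hY with rfl | rfl
        · exact ⟨hA, hAc⟩
        · exact ⟨hB, hBc⟩)
      (by rw [hD]; exact hU)
    rw [hD, sum_pair hAB] at h
    linarith

/-- `Σ_{insert a s} f ≤ f a + Σ_s f` for a nonnegative summand [folklore] -/
theorem sum_insert_le_of_nonneg' {α : Type*} [DecidableEq α] {f : α → ℝ} {a : α} {s : Finset α}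
    (ha : 0 ≤ f a) : ∑ x ∈ insert a s, f x ≤ f a + ∑ x ∈ s, f x := by
  by_cases h : a ∈ s
  · rw [insert_eq_of_mem h]; linarith
  · rw [sum_insert h]

/-- gluing three: `treeLen (C ∪ (A ∪ B)) ≤ treeLen C + treeLen A + treeLen B + 4`. [folklore] -/
theorem treeLen_union₃_le {A B C : Finset (Pt d)} (hA : A.Nonempty) (hAc : FaceConnected A) (hB : B.Nonempty)
    (hBc : FaceConnected B) (hC : C.Nonempty) (hCc : FaceConnected C) (hU : FaceConnected (C ∪ (A ∪ B))) :
    treeLen (C ∪ (A ∪ B)) ≤ treeLen C + treeLen A + treeLen B + 4 := by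
  classical
  -- the family {C, A, B} (possibly with repetitions collapsing)
  let D : Finset (Finset (Pt d)) := {C, A, B}
  have hD : D.biUnion id = C ∪ (A ∪ B) := by simp [D]
  have hmem : ∀ Y ∈ D, Y.Nonempty ∧ FaceConnected Y := fun Y hY => by
    simp only [D, mem_insert, mem_singleton] at hY
    rcases hY with rfl | rfl | rfl
    · exact ⟨hC, hCc⟩
    · exact ⟨hA, hAc⟩
    · exact ⟨hB, hBc⟩
  have h := treeLen_biUnion_add_two_le (D := D) ⟨C, by simp [D]⟩ hmem (by rw [hD]; exact hU)
  rw [hD] at h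
  -- the sum over the (≤ 3)-element family is at most the sum of the three terms
  have hle : ∑ Y ∈ D, (treeLen Y + 2) ≤ (treeLen C + 2) + ((treeLen A + 2) + (treeLen B + 2)) := by
    have h0 : ∀ Y : Finset (Pt d), 0 ≤ treeLen Y + 2 := fun Y => by linarith [treeLen_nonneg Y]
    calc ∑ Y ∈ D, (treeLen Y + 2)
        ≤ (treeLen C + 2) + ∑ Y ∈ ({A, B} : Finset (Finset (Pt d))), (treeLen Y + 2) :=
          sum_insert_le_of_nonneg' (h0 C)
      _ ≤ (treeLen C + 2) + ((treeLen A + 2) + ∑ Y ∈ ({B} : Finset (Finset (Pt d))), (treeLen Y + 2)) := by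
          gcongr; exact sum_insert_le_of_nonneg' (h0 A)
      _ = (treeLen C + 2) + ((treeLen A + 2) + (treeLen B + 2)) := by rw [sum_singleton]
  linarith

/-- **THE SKELETON IS NONEMPTY, FACE-CONNECTED, AND OF TREE LENGTH AT MOST THE EXACT PROFILE** from the step at which
the structure appears on: `treeLen (skel V n) ≤ DQ V n`.  Births: exact coarsening of the piece.  Renewals: nothing
changes.  Mergers: glue once at the merger step (`+ 4`, inside `dC`), then coarsen the merged skeleton EXACTLY; the
partners' profiles telescope (`DQ_of_le`) — no compounding across nested mergers. [folklore] -/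
theorem treeLen_skel_le (hq : ∀ l, 0 < q l) (hdC : 0 ≤ dC) :
    ∀ {G : Gen ε}, SkelOK q step piece fat dC G → ∀ {n : ℕ}, step G.top ≤ n →
      (skel q step piece G n).Nonempty ∧ FaceConnected (skel q step piece G n) ∧
        treeLen (skel q step piece G n) ≤ DQ q fat step dC G n
  | Gen.born b j, hok, n, hn => by
      obtain ⟨hb, hne, hfc, hfat⟩ := hok
      have hs : skel q step piece (Gen.born b j) n = closureIdx (Qs q j n) (piece b) := by
        simp [skel, coverAt, hb]
      rw [hs]
      refine ⟨closureIdx_nonempty hne, faceConnected_closureIdx (Qs_pos hq j n) hfc, ?_⟩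
      simp only [DQ]
      have hQ : (0 : ℝ) < Qs q j n := by exact_mod_cast Qs_pos hq j n
      rw [le_div_iff₀ hQ, mul_comm]
      exact (mul_treeLen_closureIdx_le (Qs q j n) hne hfc).trans hfat
  | Gen.renew G e h, hok, n, hn => by
      obtain ⟨hG, hpe, hse, hchron⟩ := hok
      rw [Gen.top_renew, hse] at hn
      rw [skel_renew G h hpe]
      simp only [DQ]
      exact treeLen_skel_le hq hdC hG ((step_top hG G.top G.top_mem |>.trans (hchron _ G.top_mem)).trans hn)
  | Gen.merge X Y e, hok, n, hn => by
      have hok' := hok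
      obtain ⟨hX, hY, hcX, hcY, hconn, hpc, hwe⟩ := hok'
      rw [Gen.top_merge] at hn
      set s := step e with hs
      -- the partners at the merger step
      have hXs : step X.top ≤ s := hcX _ X.top_mem
      have hYs : step Y.top ≤ s := hcY _ Y.top_mem
      obtain ⟨hXne, hXfc, hXt⟩ := treeLen_skel_le hq hdC hX hXs
      obtain ⟨hYne, hYfc, hYt⟩ := treeLen_skel_le hq hdC hY hYs
      -- all events of the merged structure have happened by `s`
      have hall : ∀ e' ∈ (Gen.merge X Y e).events, step e' ≤ s := fun e' he' => by
        rw [Gen.events_merge, mem_insert, mem_union] at he'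
        rcases he' with rfl | he' | he'
        · exact le_rfl
        · exact hcX e' he'
        · exact hcY e' he'
      -- the merged skeleton at the merger step
      have hVs : skel q step piece (Gen.merge X Y e) s =
          piece e ∪ (skel q step piece X s ∪ skel q step piece Y s) := skel_merge_self X Y e
      have hVne : (skel q step piece (Gen.merge X Y e) s).Nonempty := by
        rw [hVs]; exact (hXne.mono subset_union_left).mono subset_union_right
      have hVfc : FaceConnected (skel q step piece (Gen.merge X Y e) s) := hconn
      have hVt : treeLen (skel q step piece (Gen.merge X Y e) s) ≤
          treeLen (skel q step piece X s) + treeLen (skel q step piece Y s) + dC := by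
        rcases hpc with hpe | hpfc
        · -- no connector: glue two
          have h2 : skel q step piece (Gen.merge X Y e) s = skel q step piece X s ∪ skel q step piece Y s := by
            rw [hVs, hpe, empty_union]
          rw [h2] at hVfc ⊢
          have := treeLen_union_le hXne hXfc hYne hYfc hVfc
          have h0 := treeLen_nonneg (piece e)
          linarith
        · by_cases hpe : piece e = ∅
          · have h2 : skel q step piece (Gen.merge X Y e) s = skel q step piece X s ∪ skel q step piece Y s := by
              rw [hVs, hpe, empty_union]
            rw [h2] at hVfc ⊢
            have := treeLen_union_le hXne hXfc hYne hYfc hVfc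
            have h0 := treeLen_nonneg (piece e)
            linarith
          · have hpne : (piece e).Nonempty := nonempty_iff_ne_empty.2 hpe
            rw [hVs] at hVfc ⊢
            have := treeLen_union₃_le hXne hXfc hYne hYfc hpne hpfc hVfc
            linarith
      -- coarsen exactly from `s` to `n`
      have hsn : s ≤ n := hn
      have hVn : skel q step piece (Gen.merge X Y e) n =
          closureIdx (Qs q s n) (skel q step piece (Gen.merge X Y e) s) := skel_of_le hall hsn
      rw [hVn]
      refine ⟨closureIdx_nonempty hVne, faceConnected_closureIdx (Qs_pos hq s n) hVfc, ?_⟩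
      have hQ : (0 : ℝ) < Qs q s n := by exact_mod_cast Qs_pos hq s n
      have hcoarse := mul_treeLen_closureIdx_le (Qs q s n) hVne hVfc
      -- the profile telescopes
      have hDX : DQ q fat step dC X n = DQ q fat step dC X s / Qs q s n := DQ_of_le hq hX hcX hsn
      have hDY : DQ q fat step dC Y n = DQ q fat step dC Y s / Qs q s n := DQ_of_le hq hY hcY hsn
      simp only [DQ]
      rw [hDX, hDY, ← hs, ← add_div, ← add_div, le_div_iff₀ hQ, mul_comm]
      exact hcoarse.trans (hVt.trans (by linarith))

end TreeLen

end

end Summit.QuantumFields.BalabanUV.T4Continuum.SpaceTimePeierls
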